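import Summits.Ventures.PercRepro.RankLevelSetLevelSevenT12Cell10
import Summits.Ventures.PercRepro.RankLevelSetLevelSevenT12Cell11
import Summits.Ventures.PercRepro.RankLevelSetLevelSevenT12Cell12
import Summits.Ventures.PercRepro.RankLevelSetLevelSevenT12Cell13
import Summits.Ventures.PercRepro.RankLevelSetLevelSevenT12Cell14
import Summits.Ventures.PercRepro.RankLevelSetLevelSevenT12Cell15
import Summits.Ventures.PercRepro.RankLevelSetLevelSevenT12Cell16
import Summits.Ventures.PercRepro.RankLevelSetLevelSevenT12Cell17
import Summits.Ventures.PercRepro.RankLevelSetLevelSevenT12Cell18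
import Summits.Ventures.PercRepro.RankLevelSetLevelSevenT12Cell19
import Summits.Ventures.PercRepro.RankLevelSetLevelSevenT12Cell20
import Summits.Ventures.PercRepro.RankLevelSetLevelSevenT12Cell21
import Summits.Ventures.PercRepro.RankLevelSetLevelSevenT12Cell22
import Summits.Ventures.PercRepro.RankLevelSetLevelSevenT12Cell23
import Summits.Ventures.PercRepro.RankLevelSetLevelSevenT12Cell24
import Summits.Ventures.PercRepro.RankLevelSetLevelSevenT12Cell25
import Summits.Ventures.PercRepro.RankLevelSetLevelSevenT12Cell26
import Summits.Ventures.PercRepro.RankLevelSetLevelSevenT12Cell27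
import Summits.Ventures.PercRepro.RankLevelSetLevelSevenT12Cell28
import Summits.Ventures.PercRepro.RankLevelSetLevelSevenT12Cell29
import Summits.Ventures.PercRepro.RankLevelSetLevelSevenT12Cell30
import Summits.Ventures.PercRepro.RankLevelSetLevelSevenT12Cell31
import Summits.Ventures.PercRepro.RankLevelSetLevelSevenT12Cell32
import Summits.Ventures.PercRepro.RankLevelSetLevelSevenT12Cell33
import Summits.Ventures.PercRepro.RankLevelSetLevelSevenT12Cell34
import Summits.Ventures.PercRepro.RankLevelSetLevelSevenT12Cell35
import Summits.Ventures.PercRepro.RankLevelSetLevelSevenT12Cell36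
import Summits.Ventures.PercRepro.RankLevelSetLevelSevenT12Cell37
import Summits.Ventures.PercRepro.RankLevelSetLevelSevenT12Cell38
import Summits.Ventures.PercRepro.RankLevelSetLevelSevenT12Cell39
import Summits.Ventures.PercRepro.RankLevelSetLevelSevenT12Cell40
import Summits.Ventures.PercRepro.RankLevelSetLevelSevenT12Cell41
import Summits.Ventures.PercRepro.RankLevelSetLevelSevenT12Dev1
import Summits.Ventures.PercRepro.RankLevelSetLevelSevenT12Dev2
import Summits.Ventures.PercRepro.RankLevelSetLevelSevenT12Dev3
import Summits.Ventures.PercRepro.S4MidKeyTwelve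
import Summits.Ventures.PercRepro.S4SevenWindow
import Summits.Ventures.PercRepro.RankLevelSetLevelSixRowsNineToFifteen

/-!
# PercRepro — THE 12 ROW OF LEVEL `7`: `c025_core_seven_twelve (d ≥ 8) : RLS M 12 7` ON EVERY `e`-FREE CORE OF RANK `12`, AND
**THEOREM C₇ AT RANK `12`** (p7 g24, S4 feeder; p8's assembly shape — NO window claim, p9 owns S4)

The core cells `(12, d)`: `8 ≤ d ≤ 74` by the coloop device with the lossy ladder (`c025_core_seven_twelve_<d>`: `k` coloops reduce to the natural cell
`(12 − k, d)` of the row `12 − k` at the same corank, the rest retired — the device cells `RankLevelSetLevelSevenT12Cell<d>` for `d ∈ {10 … 41}` and the generic device `c025_core_seven_of_cells` in RankLevelSetLevelSevenT12Dev1, RankLevelSetLevelSevenT12Dev2, RankLevelSetLevelSevenT12Dev3),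
`d ≥ 75` by p1's middle key (`S4Mid.c025_core_seven_midkey_twelve`, no coloop-freeness needed). Then the level-6 glue `rls_seven_at_of_core 12` on `c025_six_all`
(level `6` at `p = 11`) gives level `7` at `p = 12`: **`c025_seven_at_twelve : RLS M 12 7`** for every finite matroid.
Axioms: standard.
-/

open scoped Matroid

namespace PercRepro

namespace ThmN

variable {α : Type}

/-- **The core cell `(12, d)` at every corank `d ≥ 8`, every `e`-free core.** -/
theorem c025_core_seven_twelve (M : Matroid α) [M.Finite] (d : ℕ) (hd8 : 8 ≤ d)
    (hR : M.eRank = (12 : ℕ∞)) (hn : M.E.ncard = 12 + d)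
    (hfree : ∀ e ∈ M.E, ∃ A ⊆ M.E \ {e}, e ∉ M.closure A ∧ e ∉ M.closure ((M.E \ {e}) \ A)) :
    RLS M 12 7 := by
  rcases Nat.lt_or_ge d 75 with hlt | hge
  · interval_cases d
    · exact c025_core_seven_twelve_8 M hR hn hfree
    · exact c025_core_seven_twelve_9 M hR hn hfree
    · exact c025_core_seven_twelve_10 M hR hn hfree
    · exact c025_core_seven_twelve_11 M hR hn hfree
    · exact c025_core_seven_twelve_12 M hR hn hfree
    · exact c025_core_seven_twelve_13 M hR hn hfree
    · exact c025_core_seven_twelve_14 M hR hn hfree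
    · exact c025_core_seven_twelve_15 M hR hn hfree
    · exact c025_core_seven_twelve_16 M hR hn hfree
    · exact c025_core_seven_twelve_17 M hR hn hfree
    · exact c025_core_seven_twelve_18 M hR hn hfree
    · exact c025_core_seven_twelve_19 M hR hn hfree
    · exact c025_core_seven_twelve_20 M hR hn hfree
    · exact c025_core_seven_twelve_21 M hR hn hfree
    · exact c025_core_seven_twelve_22 M hR hn hfree
    · exact c025_core_seven_twelve_23 M hR hn hfree
    · exact c025_core_seven_twelve_24 M hR hn hfree
    · exact c025_core_seven_twelve_25 M hR hn hfree
    · exact c025_core_seven_twelve_26 M hR hn hfree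
    · exact c025_core_seven_twelve_27 M hR hn hfree
    · exact c025_core_seven_twelve_28 M hR hn hfree
    · exact c025_core_seven_twelve_29 M hR hn hfree
    · exact c025_core_seven_twelve_30 M hR hn hfree
    · exact c025_core_seven_twelve_31 M hR hn hfree
    · exact c025_core_seven_twelve_32 M hR hn hfree
    · exact c025_core_seven_twelve_33 M hR hn hfree
    · exact c025_core_seven_twelve_34 M hR hn hfree
    · exact c025_core_seven_twelve_35 M hR hn hfree
    · exact c025_core_seven_twelve_36 M hR hn hfree
    · exact c025_core_seven_twelve_37 M hR hn hfree
    · exact c025_core_seven_twelve_38 M hR hn hfree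
    · exact c025_core_seven_twelve_39 M hR hn hfree
    · exact c025_core_seven_twelve_40 M hR hn hfree
    · exact c025_core_seven_twelve_41 M hR hn hfree
    · exact c025_core_seven_twelve_42 M hR hn hfree
    · exact c025_core_seven_twelve_43 M hR hn hfree
    · exact c025_core_seven_twelve_44 M hR hn hfree
    · exact c025_core_seven_twelve_45 M hR hn hfree
    · exact c025_core_seven_twelve_46 M hR hn hfree
    · exact c025_core_seven_twelve_47 M hR hn hfree
    · exact c025_core_seven_twelve_48 M hR hn hfree
    · exact c025_core_seven_twelve_49 M hR hn hfree
    · exact c025_core_seven_twelve_50 M hR hn hfree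
    · exact c025_core_seven_twelve_51 M hR hn hfree
    · exact c025_core_seven_twelve_52 M hR hn hfree
    · exact c025_core_seven_twelve_53 M hR hn hfree
    · exact c025_core_seven_twelve_54 M hR hn hfree
    · exact c025_core_seven_twelve_55 M hR hn hfree
    · exact c025_core_seven_twelve_56 M hR hn hfree
    · exact c025_core_seven_twelve_57 M hR hn hfree
    · exact c025_core_seven_twelve_58 M hR hn hfree
    · exact c025_core_seven_twelve_59 M hR hn hfree
    · exact c025_core_seven_twelve_60 M hR hn hfree
    · exact c025_core_seven_twelve_61 M hR hn hfree
    · exact c025_core_seven_twelve_62 M hR hn hfree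
    · exact c025_core_seven_twelve_63 M hR hn hfree
    · exact c025_core_seven_twelve_64 M hR hn hfree
    · exact c025_core_seven_twelve_65 M hR hn hfree
    · exact c025_core_seven_twelve_66 M hR hn hfree
    · exact c025_core_seven_twelve_67 M hR hn hfree
    · exact c025_core_seven_twelve_68 M hR hn hfree
    · exact c025_core_seven_twelve_69 M hR hn hfree
    · exact c025_core_seven_twelve_70 M hR hn hfree
    · exact c025_core_seven_twelve_71 M hR hn hfree
    · exact c025_core_seven_twelve_72 M hR hn hfree
    · exact c025_core_seven_twelve_73 M hR hn hfree
    · exact c025_core_seven_twelve_74 M hR hn hfree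
  · exact S4Mid.c025_core_seven_midkey_twelve M (by omega) hfree

/-- **THEOREM C₇ AT RANK `12`**: level `7` at `p = 12` for every finite matroid (on level `6` at `p = 11`, `c025_six_all`). -/
theorem c025_seven_at_twelve (M : Matroid α) [M.Finite] : RLS M 12 7 :=
  rls_seven_at_of_core 12 (by norm_num) (fun M _ => c025_six_all M 11 (by norm_num))
    (fun M _ d hd hR hn hfree => c025_core_seven_twelve M d hd hR hn hfree) M

end ThmN

end PercRepro
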